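import Summits.BirchSwinnertonDyer.BirchSwinnertonDyer.Theses.KatoDescentPotSupersingular
import Summits.BirchSwinnertonDyer.BirchSwinnertonDyer.Theorems.KatoDescentPotSupersingularWildLowerHalfRankZero
import Literature.NumberTheory.EllipticCurves.BSDShaProofs
import HarnessLib

/-!
# Route `KatoDescentPotSupersingular` (rung K9, cell `bsd-potss`): the PER-PAIR CERTIFICATE ROAD to the
# crux `WildLowerHalfRankZero` (L₀, item stmt-BirchSwinnertonDyer-19195) — one element of order `3` in
# `Ш` + the Cassels–Tate square (a `--supports … --as helper` file)

What L₀ asks on an INTRINSIC wild class (every member has `3 ∣ #Ш_an`; census WILD-L0-CENSUS.md on the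
item: 1 770 classes, `#Ш_an = 9` at the minimal member on 1 759 of them, `81` on 11) is a LOWER bound
`ord₃ #Ш(E) ≥ ord₃ #Ш_an(E)`. Class-wide this is Kato's Conj. 12.10 at `3` (generation 0, kernel iff
on the (12.5.2) rows). PER PAIR it is a finite computation, and this file types the exact interface:

* §1 (pure algebra + Cassels–Tate): ONE element `x ≠ 0` of `Ш(E/ℚ)` with `p • x = 0` forces
  `p ∣ #Ш` (`addOrderOf`), and with the Cassels–Tate pairing (`exists_casselsTate_pairing`, the tree's
  named fact bsd.S18, through its PROVED corollary `isSquare_card_sha_of_finite_of_casselsTate`: `#Ш`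
  is a perfect square when finite) `p² ∣ #Ш`, i.e. `2 ≤ ord_p #Ш`;
* §2 hence `MissingLowerBoundAt W p` at every pair of analytic rank `≤ 1` (GZK: `Ш` finite) whose
  `#Ш_an = q` has `ord_p q ≤ 2` and whose `Ш` has a `p`-torsion witness — and, by Cassels' transport of
  the lower half along the class (generation 0's `missingLowerBoundAt_wild_of_isIsogenous_unit` pattern,
  `TwistComparison.missingLowerBoundAt_of_isIsogenous`), at EVERY member of a wild class ONE of whose
  members has `ord₃ #Ш_an ≤ 2` and a witness: on 1 759 / 1 770 intrinsic census classes L₀ is ONE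
  `3`-descent (on the 144 reducible ones a `3`-isogeny descent) exhibiting `Ш[3] ≠ 0` at one member;
* §3 the BC5 plan-only rung `Sig.stub_lower_mod3_rung` of the registered skeleton (v2/v3:
  `3 ∣ #Ш_an ⇒ 1 ≤ ord₃ #Ш`) VERBATIM from GZK and a witness per row (no Cassels–Tate needed), and its
  sharpening to `2 ≤ ord₃ #Ш` with Cassels–Tate;
* §4 the crux BY NAME from the published inputs, a witness on every SHALLOW intrinsic class (a member
  with `ord₃ #Ш_an ≤ 2`) and the DEEP classes (every member `ord₃ #Ш_an ≥ 3`; census: the 11 classes with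
  `#Ш_an = 81`, where a witness certifies only the rung) displayed as the residual hypothesis.

HONEST LABEL: a witness `x ∈ Ш(E)[p] ∖ 0` is an OBJECT the tree cannot construct today (a locally
trivial torsor with no rational point); the hypotheses `hwit` below are per-pair certificate SLOTS, so
every theorem here is conditional and the item is NOT closed. Class-wide, "every intrinsic class has a
witness" is the crux again (in rank 0, `Ш[3] ≠ 0 ⟸ 3 ∣ #Ш_an` IS the lower half truncated at 1).
Nothing is booked. Seat `bsd-potss-k9-c2` (prover-bsd-potss-k9-c2-g2-0), generation 2.

References: [SilvermanAEC2009] Thm. X.4.14 (Cassels–Tate; "if `Ш` is finite its order is a perfect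
square"); [Cassels1962ArithmeticIV]; [MilneADT2006] Thm. I.7.3; [Miller2011LMS] Def. 1.1;
[Kato2004Asterisque] Conj. 12.10 (p. 224); [SchaeferStoll2004] (explicit `p`-descent, the certificate engine).
-/

set_option autoImplicit false
-- sibling precedent (`KatoDescentPotSupersingularAssembly.lean`): the directory name repeats the summit name
set_option linter.dupNamespace false

noncomputable section

open scoped Classical

namespace Summit.BirchSwinnertonDyer.BirchSwinnertonDyer.Theorems

open WeierstrassCurve Literature.NumberTheory.EllipticCurves
  Literature.NumberTheory.EllipticCurves.Rank1Residual
  Literature.NumberTheory.EllipticCurves.Rank1Residual.Typed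
  Summit.BirchSwinnertonDyer.Rank1Residual.Additive
  Summit.BirchSwinnertonDyer.Rank1Residual
  Summit.BirchSwinnertonDyer.BirchSwinnertonDyer.Theses.KatoDescentPotSupersingular

/-! ## §1 A `p`-torsion witness in a finite `Ш`: `p ∣ #Ш`, and `p² ∣ #Ш` by Cassels–Tate -/

section Witness

variable (W : WeierstrassCurve ℚ) [W.IsElliptic] (p : ℕ) [hp : Fact p.Prime]

omit [W.IsElliptic] in
/-- **A nonzero `p`-torsion element of a finite `Ш(E/ℚ)` forces `p ∣ #Ш`**: its additive order is `p`
and divides `Nat.card Ш = shaOrder`. Pure group theory. [folklore] -/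
theorem dvd_shaOrder_of_torsionWitness [Finite W.sha] {x : W.sha} (hx : x ≠ 0) (hpx : p • x = 0) :
    p ∣ W.shaOrder := by
  have hdvd : addOrderOf x ∣ p := addOrderOf_dvd_of_nsmul_eq_zero hpx
  have hne : addOrderOf x ≠ 1 := fun h1 ↦ hx (AddMonoid.addOrderOf_eq_one_iff.mp h1)
  have heq : addOrderOf x = p := (hp.out.eq_one_or_self_of_dvd _ hdvd).resolve_left hne
  rw [WeierstrassCurve.shaOrder, ← heq]
  exact addOrderOf_dvd_natCard x

/-- **With the Cassels–Tate pairing, a `p`-torsion witness forces `p² ∣ #Ш`**: `#Ш` is a perfect square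
when finite (the tree's PROVED corollary `isSquare_card_sha_of_finite_of_casselsTate` of the named fact
`exists_casselsTate_pairing`, Silverman X.4.14), and `p ∣ m²` gives `p ∣ m`. Conditional on `hCT`.
[cite: SilvermanAEC2009, Thm. X.4.14] [cite: Cassels1962ArithmeticIV] -/
theorem sq_dvd_shaOrder_of_torsionWitness_of_casselsTate (hCT : exists_casselsTate_pairing (K := ℚ))
    [Finite W.sha] {x : W.sha} (hx : x ≠ 0) (hpx : p • x = 0) : p ^ 2 ∣ W.shaOrder := by
  obtain ⟨m, hm⟩ := isSquare_card_sha_of_finite_of_casselsTate hCT W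
  have hpdvd : p ∣ m * m := by
    have := dvd_shaOrder_of_torsionWitness W p hx hpx
    rwa [WeierstrassCurve.shaOrder, hm] at this
  have hpm : p ∣ m := by
    rcases (Nat.Prime.dvd_mul hp.out).mp hpdvd with h | h <;> exact h
  rw [WeierstrassCurve.shaOrder, hm, pow_two]
  exact Nat.mul_dvd_mul hpm hpm

omit [W.IsElliptic] in
/-- **`1 ≤ ord_p #Ш` from a witness** (finite `Ш`, no Cassels–Tate). [folklore] -/
theorem one_le_padicValNat_shaOrder_of_torsionWitness [Finite W.sha] {x : W.sha} (hx : x ≠ 0)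
    (hpx : p • x = 0) : 1 ≤ padicValNat p W.shaOrder := by
  have hne : W.shaOrder ≠ 0 := by
    rw [WeierstrassCurve.shaOrder]; exact (Nat.card_pos (α := W.sha)).ne'
  exact (padicValNat_dvd_iff_le hne).mp (by simpa using dvd_shaOrder_of_torsionWitness W p hx hpx)

/-- **`2 ≤ ord_p #Ш` from a witness and Cassels–Tate** (finite `Ш`). Conditional on `hCT`.
[cite: SilvermanAEC2009, Thm. X.4.14] -/
theorem two_le_padicValNat_shaOrder_of_torsionWitness_of_casselsTate
    (hCT : exists_casselsTate_pairing (K := ℚ)) [Finite W.sha] {x : W.sha} (hx : x ≠ 0)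
    (hpx : p • x = 0) : 2 ≤ padicValNat p W.shaOrder := by
  have hne : W.shaOrder ≠ 0 := by
    rw [WeierstrassCurve.shaOrder]; exact (Nat.card_pos (α := W.sha)).ne'
  exact (padicValNat_dvd_iff_le hne).mp (sq_dvd_shaOrder_of_torsionWitness_of_casselsTate W p hCT hx hpx)

end Witness

/-! ## §2 The lower half at a SHALLOW pair from one witness, and along the class -/

section Shallow

variable (W : WeierstrassCurve ℚ) [W.IsElliptic] (p : ℕ) [hp : Fact p.Prime]

/-- **L₀ at a pair with `ord_p #Ш_an ≤ 1` from a witness** (GZK `hGZK` for the finiteness of `Ш` in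
analytic rank `≤ 1`; no Cassels–Tate). Conditional on `hGZK` and the witness slot.
[cite: Miller2011LMS, Def. 1.1] [cite: Darmon2004, Thm. 3.22] -/
theorem missingLowerBoundAt_of_torsionWitness_of_le_one
    (hGZK : rank_eq_analyticRank_of_analyticRank_le_one) (hr : W.analyticRank ≤ 1) {q : ℚ}
    (hq : shaAn W = (q : ℂ)) (hv : padicValRat p q ≤ 1) {x : W.sha} (hx : x ≠ 0) (hpx : p • x = 0) :
    MissingLowerBoundAt W p := by
  haveI : Finite W.sha := (hGZK W hr).2
  have h1 := one_le_padicValNat_shaOrder_of_torsionWitness W p hx hpx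
  exact ⟨q, hq, hv.trans (by exact_mod_cast h1)⟩

/-- **L₀ at a pair with `ord_p #Ш_an ≤ 2` from a witness and Cassels–Tate** — the case of 1 759 / 1 770
intrinsic wild census classes at their minimal member (`#Ш_an = 9`): ONE nonzero element of `Ш(E)[3]`
settles the pair. Conditional on `hCT`, `hGZK` and the witness slot.
[cite: SilvermanAEC2009, Thm. X.4.14] [cite: Miller2011LMS, Def. 1.1] -/
theorem missingLowerBoundAt_of_torsionWitness_of_le_two (hCT : exists_casselsTate_pairing (K := ℚ))
    (hGZK : rank_eq_analyticRank_of_analyticRank_le_one) (hr : W.analyticRank ≤ 1) {q : ℚ}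
    (hq : shaAn W = (q : ℂ)) (hv : padicValRat p q ≤ 2) {x : W.sha} (hx : x ≠ 0) (hpx : p • x = 0) :
    MissingLowerBoundAt W p := by
  haveI : Finite W.sha := (hGZK W hr).2
  have h2 := two_le_padicValNat_shaOrder_of_torsionWitness_of_casselsTate W p hCT hx hpx
  exact ⟨q, hq, hv.trans (by exact_mod_cast h2)⟩

end Shallow

/-- **L₀ at EVERY member of a wild class one of whose members is shallow with a witness.** For `W`
globally minimal of analytic rank `0` in `ClassO6 W 3`: if SOME globally minimal `W' ∼_ℚ W` has
`#Ш_an(W') = q'` with `ord₃ q' ≤ 2` and a nonzero `x ∈ Ш(W')` with `3 • x = 0`, then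
`MissingLowerBoundAt W 3` — §2 at `W'`, then Cassels' transport of the lower half (the class defect
`ord₃ #Ш − ord₃ #Ш_an` is an isogeny invariant over Cassels `hCassels` + GZK + modularity,
`TwistComparison.missingLowerBoundAt_of_isIsogenous`). Conditional on the four published facts and the
witness slot. [cite: MilneADT2006, Thm. I.7.3] [cite: SilvermanAEC2009, Thm. X.4.14] [cite: Miller2011LMS, Def. 1.1] -/
theorem missingLowerBoundAt_wild_of_isIsogenous_shallowWitness
    (hCT : exists_casselsTate_pairing (K := ℚ)) (hCassels : bsdRHS_eq_of_isIsogenous)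
    (hGZK : rank_eq_analyticRank_of_analyticRank_le_one) (hmod : hasEntireLFunction_rat)
    (W : WeierstrassCurve ℚ) [W.IsElliptic] [W.IsGloballyMinimal] [Fact (3 : ℕ).Prime]
    (hr : W.analyticRank = 0) (_hO : ClassO6 W 3)
    (W' : WeierstrassCurve ℚ) [W'.IsElliptic] [W'.IsGloballyMinimal] (hiso : IsIsogenous W W')
    {q' : ℚ} (hq' : shaAn W' = (q' : ℂ)) (hv' : padicValRat 3 q' ≤ 2) {x : W'.sha} (hx : x ≠ 0)
    (h3x : 3 • x = 0) : MissingLowerBoundAt W 3 := by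
  have hr' : W'.analyticRank ≤ 1 := by
    rw [← analyticRank_eq_of_isIsogenous' hiso, hr]; exact zero_le_one
  exact TwistComparison.missingLowerBoundAt_of_isIsogenous W' W 3 hCassels hGZK hmod
    hiso.symm_of_charZero hr'
    (missingLowerBoundAt_of_torsionWitness_of_le_two W' 3 hCT hGZK hr' hq' hv' hx h3x)

/-! ## §3 The BC5 plan-only rung `stub_lower_mod3_rung` from witnesses -/

/-- **The registered BC5 rung `Sig.stub_lower_mod3_rung` VERBATIM, from GZK and a witness per row**:
on the wild rank-`0` rows with `3 ∣ #Ш_an(W)` (`1 ≤ ord₃ q`), `1 ≤ ord₃ #Ш(W)` — granted, on each such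
row, a nonzero element of `Ш(W)` killed by `3` (`hwit`, the per-pair `3`-descent certificate slot). No
Cassels–Tate. The class-wide content of `hwit` is the rung itself (in rank `0`, `Ш[3] ≠ 0 ⟸ 3 ∣ #Ш_an`
is the lower half truncated at `1`): a per-pair road, not a proof. Conditional; nothing credited.
[cite: Miller2011LMS, Def. 1.1] [cite: Kato2004Asterisque, Conj. 12.10 (p. 224)] -/
theorem lower_mod3_rung_of_witnesses (hGZK : rank_eq_analyticRank_of_analyticRank_le_one)
    (hwit : ∀ (W : WeierstrassCurve ℚ) [W.IsElliptic] [W.IsGloballyMinimal] [Fact (3 : ℕ).Prime],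
      W.analyticRank = 0 → ClassO6 W 3 → (∃ q : ℚ, shaAn W = (q : ℂ) ∧ 1 ≤ padicValRat 3 q) →
        ∃ x : W.sha, x ≠ 0 ∧ 3 • x = 0) :
    ∀ (W : WeierstrassCurve ℚ) [W.IsElliptic] [W.IsGloballyMinimal] [Fact (3 : ℕ).Prime],
      W.analyticRank = 0 → ClassO6 W 3 →
      (∃ q : ℚ, shaAn W = (q : ℂ) ∧ 1 ≤ padicValRat 3 q) →
        1 ≤ padicValNat 3 W.shaOrder := by
  intro W _ _ _ hr hO hq
  obtain ⟨x, hx, h3x⟩ := hwit W hr hO hq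
  haveI : Finite W.sha := (hGZK W (by rw [hr]; exact zero_le_one)).2
  exact one_le_padicValNat_shaOrder_of_torsionWitness W 3 hx h3x

/-- **The rung SHARPENED by Cassels–Tate**: under the same witnesses, `2 ≤ ord₃ #Ш(W)` on every wild
rank-`0` row with `3 ∣ #Ш_an(W)` — so on the rows with `#Ш_an = 9·(unit)` the witness gives the full
lower half (§2). Conditional; nothing credited. [cite: SilvermanAEC2009, Thm. X.4.14] -/
theorem lower_mod9_rung_of_witnesses_of_casselsTate (hCT : exists_casselsTate_pairing (K := ℚ))
    (hGZK : rank_eq_analyticRank_of_analyticRank_le_one)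
    (hwit : ∀ (W : WeierstrassCurve ℚ) [W.IsElliptic] [W.IsGloballyMinimal] [Fact (3 : ℕ).Prime],
      W.analyticRank = 0 → ClassO6 W 3 → (∃ q : ℚ, shaAn W = (q : ℂ) ∧ 1 ≤ padicValRat 3 q) →
        ∃ x : W.sha, x ≠ 0 ∧ 3 • x = 0) :
    ∀ (W : WeierstrassCurve ℚ) [W.IsElliptic] [W.IsGloballyMinimal] [Fact (3 : ℕ).Prime],
      W.analyticRank = 0 → ClassO6 W 3 →
      (∃ q : ℚ, shaAn W = (q : ℂ) ∧ 1 ≤ padicValRat 3 q) →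
        2 ≤ padicValNat 3 W.shaOrder := by
  intro W _ _ _ hr hO hq
  obtain ⟨x, hx, h3x⟩ := hwit W hr hO hq
  haveI : Finite W.sha := (hGZK W (by rw [hr]; exact zero_le_one)).2
  exact two_le_padicValNat_shaOrder_of_torsionWitness_of_casselsTate W 3 hCT hx h3x

/-! ## §4 The crux BY NAME: unit classes (published), shallow intrinsic classes (one witness each),
deep classes (displayed) -/

/-- **`WildLowerHalfRankZero` from the published inputs, ONE WITNESS PER SHALLOW INTRINSIC CLASS, and
the DEEP classes displayed.** Inputs: Cassels–Tate `hCT`, Cassels `hCassels`, GZK `hGZK`, modularity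
`hmod` (published); `hwit`: on every wild rank-`0` row lying in a class with NO `3`-adic-unit member but
SOME globally minimal member `W'` with `ord₃ #Ш_an(W') ≤ 2`, a witness at such a member (per-class
`3`-descent certificate slot — census: 1 759 classes, 8 of the 10 with `N < 2·10⁴` already certified
`dim Ш[3] = 2` by the b2b sha-2 census); `hdeep`: the lower half on the rows of the DEEP classes (every
globally minimal member has `ord₃ #Ш_an ≥ 3`; census: 11 classes, `#Ш_an = 81`), displayed — there a
`3`-torsion witness gives only `ord₃ #Ш ≥ 2` and a full certificate needs `#Ш[9]` (second descent).
Unit-member classes by generation 0's `missingLowerBoundAt_wild_of_isIsogenous_unit`. HONEST LABEL: a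
per-pair road made uniform by hypothesis; class-wide `hwit` is the crux's own content. Conditional; the
item is NOT closed. [cite: SilvermanAEC2009, Thm. X.4.14] [cite: MilneADT2006, Thm. I.7.3]
[cite: Miller2011LMS, Def. 1.1] [cite: Kato2004Asterisque, Conj. 12.10 (p. 224)] -/
theorem wildLowerHalfRankZero_of_shallowWitnesses_of_deepRows
    (hCT : exists_casselsTate_pairing (K := ℚ)) (hCassels : bsdRHS_eq_of_isIsogenous)
    (hGZK : rank_eq_analyticRank_of_analyticRank_le_one) (hmod : hasEntireLFunction_rat)
    (hwit : ∀ (W : WeierstrassCurve ℚ) [W.IsElliptic] [W.IsGloballyMinimal] [Fact (3 : ℕ).Prime],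
      W.analyticRank = 0 → ClassO6 W 3 →
      (∀ (W' : WeierstrassCurve ℚ) [W'.IsElliptic] [W'.IsGloballyMinimal], IsIsogenous W W' →
        ∀ q' : ℚ, shaAn W' = (q' : ℂ) → 0 < padicValRat 3 q') →
      (∃ (W' : WeierstrassCurve ℚ) (_ : W'.IsElliptic) (_ : W'.IsGloballyMinimal),
        IsIsogenous W W' ∧ ∃ q' : ℚ, shaAn W' = (q' : ℂ) ∧ padicValRat 3 q' ≤ 2) →
      ∃ (W' : WeierstrassCurve ℚ) (_ : W'.IsElliptic) (_ : W'.IsGloballyMinimal),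
        IsIsogenous W W' ∧ ∃ q' : ℚ, shaAn W' = (q' : ℂ) ∧ padicValRat 3 q' ≤ 2 ∧
          ∃ x : W'.sha, x ≠ 0 ∧ 3 • x = 0)
    (hdeep : ∀ (W : WeierstrassCurve ℚ) [W.IsElliptic] [W.IsGloballyMinimal] [Fact (3 : ℕ).Prime],
      W.analyticRank = 0 → ClassO6 W 3 →
      (∀ (W' : WeierstrassCurve ℚ) [W'.IsElliptic] [W'.IsGloballyMinimal], IsIsogenous W W' →
        ∀ q' : ℚ, shaAn W' = (q' : ℂ) → 2 < padicValRat 3 q') → MissingLowerBoundAt W 3) :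
    Summit.BirchSwinnertonDyer.BirchSwinnertonDyer.Theses.KatoDescentPotSupersingular.WildLowerHalfRankZero := by
  intro W _ _ _ hr hO
  by_cases hunit : ∃ (W' : WeierstrassCurve ℚ) (_ : W'.IsElliptic) (_ : W'.IsGloballyMinimal),
      IsIsogenous W W' ∧ ∃ q' : ℚ, shaAn W' = (q' : ℂ) ∧ padicValRat 3 q' ≤ 0
  · obtain ⟨W', hW', hM', hiso, q', hq', hv'⟩ := hunit
    haveI := hW'
    haveI := hM'
    exact missingLowerBoundAt_wild_of_isIsogenous_unit hCassels hGZK hmod W hr hO W' hiso hq' hv'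
  · have hnon : ∀ (W' : WeierstrassCurve ℚ) [W'.IsElliptic] [W'.IsGloballyMinimal], IsIsogenous W W' →
        ∀ q' : ℚ, shaAn W' = (q' : ℂ) → 0 < padicValRat 3 q' :=
      fun W' hW' hM' hiso q' hq' ↦ lt_of_not_ge fun hv' ↦ hunit ⟨W', hW', hM', hiso, q', hq', hv'⟩
    by_cases hshallow : ∃ (W' : WeierstrassCurve ℚ) (_ : W'.IsElliptic) (_ : W'.IsGloballyMinimal),
        IsIsogenous W W' ∧ ∃ q' : ℚ, shaAn W' = (q' : ℂ) ∧ padicValRat 3 q' ≤ 2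
    · obtain ⟨W', hW', hM', hiso, q', hq', hv', x, hx, h3x⟩ := hwit W hr hO hnon hshallow
      haveI := hW'
      haveI := hM'
      exact missingLowerBoundAt_wild_of_isIsogenous_shallowWitness hCT hCassels hGZK hmod W hr hO W'
        hiso hq' hv' hx h3x
    · exact hdeep W hr hO fun W' hW' hM' hiso q' hq' ↦
        lt_of_not_ge fun hv' ↦ hshallow ⟨W', hW', hM', hiso, q', hq', hv'⟩

end Summit.BirchSwinnertonDyer.BirchSwinnertonDyer.Theorems

end
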